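import Mathlib
import HarnessLib
import Literature.AlgebraicGeometry.Ramification.InertiaNormalSylow
import Literature.AlgebraicGeometry.Resolution.AugmentationIdeal
import Literature.RingTheory.CompleteLocalRings.TameAutomorphismCotangent
import Summits.ResolutionOfSingularities.ResolutionOfSingularities.Theorems.WildQuotientsWildQuotientResolutionTameFixedLocus
import Summits.ResolutionOfSingularities.ResolutionOfSingularities.Theorems.WildQuotientsWildQuotientResolutionNpcTameElement

/-!
# The cotangent representation of a residue-trivial action, and tame elements of fixed-locus codimension ≥ 2 at non-p-closed points
# (crux `WildQuotients.WildQuotientResolution`, stub `stub_phaseZeroHighDim`; any dimension)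

Crux stmt-ResolutionOfSingularities-15640 (`WildQuotientResolution`), registered stub `stub_phaseZeroHighDim`.
✓`NpcTameElement.exists_tame_two_le_finrank` (p820246) is a statement about linear representations. This file supplies
the representation it is meant for — the COTANGENT REPRESENTATION `I → GL_κ(𝔪/𝔪²)` of a residue-trivial action
`τ : I →* Aut(A)` on a local ring (`κ`-LINEAR because `τ` is residue-trivial; stated as an existence theorem with its
characterising formula, so that this file stays definition-free) — proves that its elements of order prime to the
residue characteristic act faithfully (✓`TameAutomorphismCotangent`, Serre IV §2), and concludes:

**Theorem** (`exists_tame_fixedIdeal_two_le`). Let `(A, 𝔪, κ)` be a Noetherian local ring of residue characteristic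
`p` and `τ` a faithful residue-trivial action of a finite group `I` which is NOT p-closed. Then some
`t ∈ ⟨p-elements of I⟩` of order prime to `p` has a fixed-locus ideal `I_{τ t} = (τ t − 1)A` whose differentials span
a subspace of dimension `≥ 2` of `𝔪/𝔪²`; for `A` regular, `Fix(t)` is then a regular centre of codimension `≥ 2`
through the point (✓`TameFixedLocus`): at every non-p-closed point a genuine TAME MOVE is available
(✓`tameMove` p819797; evidence memo PHASE0-TAME-CENTRE-ORDER.md on the item, (E3)).

[OURS · crux stmt-ResolutionOfSingularities-15640 · helper toward `stub_phaseZeroHighDim`; folklore local algebra,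
counted 0; AI-level work, weaker than expert review.] [folklore]

* `maximalIdeal_le_comap` — residue-trivial automorphisms preserve `𝔪`;
* `exists_cotangentRep` — the `κ`-linear representation `φ : I →* (𝔪/𝔪² ≃ₗ[κ] 𝔪/𝔪²)` with `φ g [x] = [τ g x]`;
* `apply_sub_mem_sq_of_cotangentRep_eq_one`, `eq_one_of_cotangentRep_eq_one` — `φ g = 1` iff `τ g` is
  cotangent-trivial; for `g` of order prime to `p` this forces `g = 1` (faithful `τ`);
* `range_cotangentRep_sub_one_le` — `(φ g − 1)(𝔪/𝔪²)` consists of differentials of elements of `I_{τ g}`;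
* `exists_tame_two_le_finrank_cotangent`, `exists_tame_fixedIdeal_two_le` — the theorem.
-/

-- single-problem summit: the doubled namespace component `ResolutionOfSingularities` is forced
set_option linter.dupNamespace false

noncomputable section

namespace Summit.ResolutionOfSingularities.ResolutionOfSingularities.Theorems.WildQuotientResolution.CotangentRep

open IsLocalRing Literature.AlgebraicGeometry.Ramification Literature.AlgebraicGeometry.Resolution
open Literature.RingTheory.CompleteLocalRings

variable {A : Type*} [CommRing A] [IsLocalRing A]

/-! ## The cotangent representation -/

/-- A residue-trivial automorphism maps `𝔪` into `𝔪`. [folklore] -/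
theorem maximalIdeal_le_comap (σ : A ≃+* A) (hres : ∀ a : A, σ a - a ∈ maximalIdeal A) :
    maximalIdeal A ≤ (maximalIdeal A).comap (σ : A →+* A) := by
  intro x hx
  rw [Ideal.mem_comap]
  have e : (σ : A →+* A) x = x + (σ x - x) := by simp
  rw [e]
  exact add_mem hx (hres x)

section Rep

variable {I : Type*} [Group I] (τ : I →* (A ≃+* A)) (hres : ∀ (g : I) (a : A), τ g a - a ∈ maximalIdeal A)

include hres in
/-- **The cotangent representation.** A residue-trivial action `τ` of `I` on the local ring `(A, 𝔪, κ)` induces a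
representation `φ : I → GL_κ(𝔪/𝔪²)` by `κ`-LINEAR automorphisms with `φ g [x] = [τ g x]`
(`κ`-linearity: `τ(a x) − a τ(x) = (τ a − a) τ x ∈ 𝔪²`). [folklore] -/
theorem exists_cotangentRep :
    ∃ φ : I →* (CotangentSpace A ≃ₗ[ResidueField A] CotangentSpace A),
      ∀ (g : I) (x : maximalIdeal A), φ g ((maximalIdeal A).toCotangent x) =
        (maximalIdeal A).toCotangent ⟨τ g x, maximalIdeal_le_comap (τ g) (hres g) x.2⟩ := by
  classical
  -- the additive cotangent map of `σ = τ g`, and its `κ`-linearity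
  let ψ₀ : ∀ g : I, CotangentSpace A →ₗ[ℤ] CotangentSpace A := fun g =>
    Ideal.mapCotangent (maximalIdeal A) (maximalIdeal A) ((τ g : A →+* A).toIntAlgHom)
      (maximalIdeal_le_comap (τ g) (hres g))
  have hψ₀ : ∀ (g : I) (x : maximalIdeal A), ψ₀ g ((maximalIdeal A).toCotangent x) =
      (maximalIdeal A).toCotangent ⟨τ g x, maximalIdeal_le_comap (τ g) (hres g) x.2⟩ := fun g x => rfl
  have hsmul : ∀ (g : I) (c : ResidueField A) (v : CotangentSpace A), ψ₀ g (c • v) = c • ψ₀ g v := by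
    intro g c v
    obtain ⟨a, rfl⟩ := Ideal.Quotient.mk_surjective c
    obtain ⟨x, rfl⟩ := (maximalIdeal A).toCotangent_surjective v
    change ψ₀ g ((Ideal.Quotient.mk (maximalIdeal A) a) • (maximalIdeal A).toCotangent x) =
      (Ideal.Quotient.mk (maximalIdeal A) a) • ψ₀ g ((maximalIdeal A).toCotangent x)
    have h1 : (Ideal.Quotient.mk (maximalIdeal A) a) • (maximalIdeal A).toCotangent x =
        (maximalIdeal A).toCotangent (a • x) := by
      rw [LinearMap.map_smul]
      exact IsScalarTower.algebraMap_smul (ResidueField A) a _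
    have h2 : (Ideal.Quotient.mk (maximalIdeal A) a) • ψ₀ g ((maximalIdeal A).toCotangent x) =
        (maximalIdeal A).toCotangent (a • ⟨τ g x, maximalIdeal_le_comap (τ g) (hres g) x.2⟩) := by
      rw [hψ₀, LinearMap.map_smul]
      exact IsScalarTower.algebraMap_smul (ResidueField A) a _
    rw [h1, h2, hψ₀, Ideal.toCotangent_eq]
    have e : ((⟨τ g ((a • x : maximalIdeal A) : A), maximalIdeal_le_comap (τ g) (hres g) (a • x).2⟩ :
        maximalIdeal A) : A) -
        ((a • (⟨τ g x, maximalIdeal_le_comap (τ g) (hres g) x.2⟩ : maximalIdeal A) : maximalIdeal A) : A) =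
        (τ g a - a) * τ g x := by
      simp only [SetLike.val_smul, smul_eq_mul, map_mul]
      ring
    rw [e, pow_two]
    exact Ideal.mul_mem_mul (hres g a) (maximalIdeal_le_comap (τ g) (hres g) x.2)
  let ψ : ∀ g : I, CotangentSpace A →ₗ[ResidueField A] CotangentSpace A := fun g =>
    { toFun := ψ₀ g, map_add' := (ψ₀ g).map_add, map_smul' := hsmul g }
  have hψ : ∀ (g : I) (x : maximalIdeal A), ψ g ((maximalIdeal A).toCotangent x) =
      (maximalIdeal A).toCotangent ⟨τ g x, maximalIdeal_le_comap (τ g) (hres g) x.2⟩ := fun g x => rfl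
  -- functoriality
  have hone : ψ 1 = LinearMap.id := by
    apply LinearMap.ext
    intro v
    obtain ⟨x, rfl⟩ := (maximalIdeal A).toCotangent_surjective v
    rw [hψ]
    simp only [map_one, LinearMap.id_coe, id_eq]
    rfl
  have hmul : ∀ g h : I, ψ (g * h) = ψ g ∘ₗ ψ h := by
    intro g h
    apply LinearMap.ext
    intro v
    obtain ⟨x, rfl⟩ := (maximalIdeal A).toCotangent_surjective v
    rw [LinearMap.comp_apply, hψ, hψ, hψ]
    simp only [map_mul, RingAut.mul_apply]
  -- the automorphisms and the representation
  let E : I → (CotangentSpace A ≃ₗ[ResidueField A] CotangentSpace A) := fun g =>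
    LinearEquiv.ofLinear (ψ g) (ψ g⁻¹)
      (by rw [← hmul, mul_inv_cancel, hone])
      (by rw [← hmul, inv_mul_cancel, hone])
  have hE : ∀ (g : I) (v : CotangentSpace A), E g v = ψ g v := fun g v => rfl
  refine ⟨{ toFun := E, map_one' := ?_, map_mul' := ?_ }, fun g x => by
    change E g _ = _
    rw [hE, hψ]⟩
  · apply LinearEquiv.ext
    intro v
    rw [hE, hone]
    rfl
  · intro g h
    apply LinearEquiv.ext
    intro v
    rw [LinearEquiv.mul_apply, hE, hE, hE, hmul]
    rfl

variable (φ : I →* (CotangentSpace A ≃ₗ[ResidueField A] CotangentSpace A))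
  (hφ : ∀ (g : I) (x : maximalIdeal A), φ g ((maximalIdeal A).toCotangent x) =
    (maximalIdeal A).toCotangent ⟨τ g x, maximalIdeal_le_comap (τ g) (hres g) x.2⟩)

include hφ

/-- If `g` acts trivially on the cotangent space then `τ g` moves `𝔪` into `𝔪²`. [folklore] -/
theorem apply_sub_mem_sq_of_cotangentRep_eq_one {g : I} (h1 : φ g = 1)
    {x : A} (hx : x ∈ maximalIdeal A) : τ g x - x ∈ maximalIdeal A ^ 2 := by
  have h := hφ g ⟨x, hx⟩
  rw [h1, LinearEquiv.coe_one, id_eq, eq_comm, Ideal.toCotangent_eq] at h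
  exact h

/-- **Elements of order prime to `p` act faithfully on the cotangent space** (`τ` faithful, `A` Noetherian of
residue characteristic `p`; ✓`ringEquiv_eq_one_of_cotangentTrivial_of_isUnit_orderOf`). [folklore] -/
theorem eq_one_of_cotangentRep_eq_one [IsNoetherianRing A] [Finite I] (p : ℕ) [Fact p.Prime]
    [CharP (ResidueField A) p] (hτ : Function.Injective τ) {g : I} (hg : (orderOf g).Coprime p)
    (h1 : φ g = 1) : g = 1 := by
  have hp : p.Prime := Fact.out
  have hcot : ∀ a ∈ maximalIdeal A, τ g a - a ∈ maximalIdeal A ^ 2 :=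
    fun a ha => apply_sub_mem_sq_of_cotangentRep_eq_one τ hres φ hφ h1 ha
  have hdvd : orderOf (τ g) ∣ orderOf g := orderOf_map_dvd τ g
  have hndvd : ¬ p ∣ orderOf (τ g) := fun h =>
    (Nat.Prime.coprime_iff_not_dvd hp).mp hg.symm (h.trans hdvd)
  have hunit : IsUnit ((orderOf (τ g) : ℕ) : A) := TameFixedLocus.isUnit_natCast_of_not_dvd p hndvd
  have hord : 0 < orderOf (τ g) := (τ.isOfFinOrder (isOfFinOrder_of_finite g)).orderOf_pos
  have h : τ g = 1 := ringEquiv_eq_one_of_cotangentTrivial_of_isUnit_orderOf (τ g) (hres g) hcot hunit hord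
  exact hτ (by rw [h, map_one])

/-- The subspace moved by `g` on the cotangent space consists of differentials of elements of the fixed-locus
ideal `I_{τ g}`: `(φ g − 1)(𝔪/𝔪²) ⊆ κ · d(I_{τ g} ∩ 𝔪)`. [folklore] -/
theorem range_cotangentRep_sub_one_le (g : I) :
    LinearMap.range ((φ g : CotangentSpace A →ₗ[ResidueField A] CotangentSpace A) - 1) ≤
      Submodule.span (ResidueField A)
        ((maximalIdeal A).toCotangent '' {x : maximalIdeal A | (x : A) ∈ augIdeal (τ g)}) := by
  rintro v ⟨w, rfl⟩
  obtain ⟨x, rfl⟩ := (maximalIdeal A).toCotangent_surjective w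
  apply Submodule.subset_span
  refine ⟨⟨τ g (x : A) - (x : A), sub_mem (maximalIdeal_le_comap (τ g) (hres g) x.2) x.2⟩,
    sub_mem_augIdeal (τ g) (x : A), ?_⟩
  have e : (⟨τ g (x : A) - (x : A), sub_mem (maximalIdeal_le_comap (τ g) (hres g) x.2) x.2⟩ :
      maximalIdeal A) = ⟨τ g (x : A), maximalIdeal_le_comap (τ g) (hres g) x.2⟩ - x := by
    apply Subtype.ext
    simp
  rw [e, map_sub, LinearMap.sub_apply, Module.End.one_apply, LinearEquiv.coe_coe, hφ]

/-- **At a non-p-closed point a tame element moving a plane of the cotangent space exists** (for a given cotangent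
representation): for a faithful residue-trivial action `τ` of a finite NON-p-closed group `I` on a Noetherian local
ring of residue characteristic `p`, some `t ∈ ⟨p-elements⟩ ≤ I` of order prime to `p` has
`dim (φ t − 1)(𝔪/𝔪²) ≥ 2` (✓`NpcTameElement.exists_tame_two_le_finrank`). [folklore] -/
theorem exists_tame_two_le_finrank_cotangent [IsNoetherianRing A] [Finite I] (p : ℕ) [Fact p.Prime]
    [CharP (ResidueField A) p] (hτ : Function.Injective τ) (hI : ¬ HasNormalSylow p I) :
    ∃ t ∈ Subgroup.closure {g : I | ∃ n : ℕ, g ^ p ^ n = 1}, (orderOf t).Coprime p ∧ t ≠ 1 ∧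
      2 ≤ Module.finrank (ResidueField A) (LinearMap.range
        ((φ t : CotangentSpace A →ₗ[ResidueField A] CotangentSpace A) - 1)) :=
  NpcTameElement.exists_tame_two_le_finrank p φ
    (fun _ ht h1 => eq_one_of_cotangentRep_eq_one τ hres φ hφ p hτ ht h1) hI

end Rep

/-- **Ideal-theoretic form, no representation in the statement**: for a faithful residue-trivial action `τ` of a
finite NON-p-closed group `I` on a Noetherian local ring `(A, 𝔪, κ)` of residue characteristic `p`, some
`t ∈ ⟨p-elements⟩ ≤ I` of order prime to `p` has a fixed-locus ideal `I_{τ t}` whose differentials span a subspace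
of dimension `≥ 2` of `𝔪/𝔪²` — for `A` regular, `Fix(t)` has codimension `≥ 2` (✓`TameFixedLocus`). [folklore] -/
theorem exists_tame_fixedIdeal_two_le [IsNoetherianRing A] {I : Type*} [Group I] [Finite I]
    (τ : I →* (A ≃+* A)) (hres : ∀ (g : I) (a : A), τ g a - a ∈ maximalIdeal A) (p : ℕ) [Fact p.Prime]
    [CharP (ResidueField A) p] (hτ : Function.Injective τ) (hI : ¬ HasNormalSylow p I) :
    ∃ t ∈ Subgroup.closure {g : I | ∃ n : ℕ, g ^ p ^ n = 1}, (orderOf t).Coprime p ∧ t ≠ 1 ∧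
      2 ≤ Module.finrank (ResidueField A) (Submodule.span (ResidueField A)
        ((maximalIdeal A).toCotangent '' {x : maximalIdeal A | (x : A) ∈ augIdeal (τ t)})) := by
  obtain ⟨φ, hφ⟩ := exists_cotangentRep τ hres
  obtain ⟨t, htN, htc, ht1, h2⟩ := exists_tame_two_le_finrank_cotangent τ hres φ hφ p hτ hI
  exact ⟨t, htN, htc, ht1,
    h2.trans (Submodule.finrank_mono (range_cotangentRep_sub_one_le τ hres φ hφ t))⟩

end Summit.ResolutionOfSingularities.ResolutionOfSingularities.Theorems.WildQuotientResolution.CotangentRep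

end
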